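import Mathlib
import HarnessLib

/-!
# Shadow complexity of the Birkhoff polytope (Hrubeš–Yehudayoff 2021, Prop. 23)

Topic `Literature/Computability/AlgebraicComplexity`. Source: P. Hrubeš, A. Yehudayoff, *Shadows of
Newton polytopes*, 36th Computational Complexity Conference (CCC 2021), LIPIcs 200, 9:1–9:23,
doi:10.4230/LIPIcs.CCC.2021.9 — open-access text read this session (pp. 9:1–9:3, 9:10–9:11,
9:16–9:18, 9:21).

Printed definitions (p. 9:1): "A shadow of a polytope `P ⊆ ℝⁿ` is a set of the form `L(P)`, where
`L : ℝⁿ → ℝ²` is a linear map. … The shadow complexity of `P` is `σ(P) = max_L |vert(L(P))|`, where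
`L` is a linear map and `vert(Q)` is the vertex set of the polytope `Q`." (p. 9:2): "The Newton
polytope of the permanent polynomial is the Birkhoff polytope `DS_n ⊆ ℝ^{n×n}`; namely, the set of
`n × n` doubly stochastic matrices. The vertices of `DS_n` are all `n × n` permutation matrices.
▶ Problem 1. What is `σ(DS_n)`?" (p. 9:3): "Carstensen's lower bound for example implies that
`σ(DS_n) ≥ 2^{Ω(log² n)}`. This is the best lower bound on `σ(DS_n)` we are aware of. The best upper
bound we know is `σ(DS_n) ≤ 2^{O(n)}`." (p. 9:10–9:11): "▶ Proposition 23.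
`2^{Ω(log² n)} ≤ σ(DS_n) ≤ 2^{O(n)}`. Proof. As pointed by Mulmuley and Shah in [37], the lower bound
for `CONN_n` translates to `DS_n`. For the upper bound, we claim that
`σ(DS_{2n}) ≤ 2·C(2n,n)·σ(DS_n)` …" (p. 9:21): "▶ Open Problem 1. Is `σ(DS_n)` or `σ(MATCH_n)`
exponential in `n`?"

## Rendering

* `permMatrixPoints n ⊆ ℝ^{Fin n × Fin n}` — the `n!` permutation matrices, entry `(i, j) = 1` iff
  `ρ j = i` (the encoding used verbatim by route item
  `Summit.ValiantsHypothesis.ValiantsHypothesis.Theses.DivisionGap.ShadowBirkhoff`); their convex hull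
  is `DS_n` (Birkhoff–von Neumann; not needed here since only the hull of the vertex set enters).
* `birkhoffShadowVertexCount L` — `|vert(L(DS_n))|` for a linear `L : ℝ^{n×n} → ℝ²`, typed as the
  number of extreme points of `convexHull ℝ (L '' permMatrixPoints n)` (`= L(DS_n)` by linearity of
  `L`, Mathlib `LinearMap.image_convexHull`; the vertices of a polygon are its extreme points).
  Hence `σ(DS_n) ≥ k ↔ ∃ L, k ≤ birkhoffShadowVertexCount L` and
  `σ(DS_n) ≤ k ↔ ∀ L, birkhoffShadowVertexCount L ≤ k` — the two named facts below are the two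
  halves of Prop. 23 in this form, with the asymptotic constants existentially quantified.
* Named facts (`def … : Prop`, D-0014; users take `(h : HrubesYehudayoff2021_prop23_lower)`):
  `HrubesYehudayoff2021_prop23_lower` (`σ(DS_n) ≥ 2^{c·log₂² n}` for some `c > 0` and all large `n`)
  and `HrubesYehudayoff2021_prop23_upper` (`σ(DS_n) ≤ 2^{C·n}` for some `C` and all large `n`).

The lower half grounds (partially) the support item `ShadowBirkhoff` of route
ValiantsHypothesis/DivisionGap, which asserts the STRONGER, open, super-quasi-polynomial growth
`∀ c, σ(DS_n) > 2^{(log₂ n + c)^c}` eventually (Hrubeš–Yehudayoff's Open Problem 1 asks even for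
`2^{Ω(n)}`); the printed state of knowledge is exactly Prop. 23. Nothing is asserted here.

## References

* P. Hrubeš, A. Yehudayoff, *Shadows of Newton polytopes*, CCC 2021, LIPIcs 200:9, Prop. 23,
  Problem 1, Open Problem 1, Theorem 4 [HrubesYehudayoff2021].
* P. Carstensen, *The complexity of some problems in parametric linear and combinatorial
  programming*, PhD thesis, Univ. of Michigan (1983) — the `2^{Ω(log² n)}` parametric shortest-path
  lower bound behind the lower half (via HY21 Thm 4 and Mulmuley–Shah) [cited through HrubesYehudayoff2021].
-/

noncomputable section

namespace Literature.Computability.AlgebraicComplexity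

/-- The `n × n` permutation matrices as points of `ℝ^{Fin n × Fin n}`: entry `(i, j)` of the matrix
of `ρ` is `1` if `ρ j = i` and `0` otherwise — "The vertices of `DS_n` are all `n × n` permutation
matrices" (the vertex set of the Birkhoff polytope `DS_n = Newt(per_n)`).
[cite: HrubesYehudayoff2021, §1, Problem 1] -/
def permMatrixPoints (n : ℕ) : Set (Fin n × Fin n → ℝ) :=
  {x | ∃ ρ : Equiv.Perm (Fin n), x = fun ij => if ρ ij.2 = ij.1 then 1 else 0}

/-- The number of vertices `|vert(L(DS_n))|` of the shadow of the Birkhoff polytope under a linear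
map `L : ℝ^{n×n} → ℝ²`, typed as the number of extreme points of the convex hull of the projected
permutation matrices (`L(DS_n) = conv(L(vert DS_n))`). The shadow complexity `σ(DS_n)` of the
source is `max_L` of this quantity. [cite: HrubesYehudayoff2021, §1 (definition of `σ(P)`)] -/
abbrev birkhoffShadowVertexCount {n : ℕ} (L : (Fin n × Fin n → ℝ) →ₗ[ℝ] (Fin 2 → ℝ)) : ℕ :=
  (Set.extremePoints ℝ (convexHull ℝ (L '' permMatrixPoints n))).ncard

/-- NAMED FACT (**Hrubeš–Yehudayoff 2021, Proposition 23, lower half**: "`2^{Ω(log² n)} ≤ σ(DS_n)`";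
"Carstensen's lower bound … implies that `σ(DS_n) ≥ 2^{Ω(log² n)}`. This is the best lower bound on
`σ(DS_n)` we are aware of"; proof: the parametric shortest-path lower bound `σ(CONN_n) = 2^{Θ(log² n)}`
(Prop. 22, Carstensen; Mulmuley–Shah) "translates to `DS_n`"). Rendered: there are `c > 0` and `n₀`
such that for every `n ≥ n₀` some linear `L : ℝ^{n×n} → ℝ²` projects the permutation matrices onto a
polygon with at least `2^{c·(log₂ n)²}` vertices. Grounds, as its printed lower rung, the (stronger,
open) route item `Summit.ValiantsHypothesis.ValiantsHypothesis.Theses.DivisionGap.ShadowBirkhoff`.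
Users take `(h : HrubesYehudayoff2021_prop23_lower)`. [cite: HrubesYehudayoff2021, Prop. 23] -/
def HrubesYehudayoff2021_prop23_lower : Prop :=
  ∃ c : ℝ, 0 < c ∧ ∃ n₀ : ℕ, ∀ n : ℕ, n₀ ≤ n →
    ∃ L : (Fin n × Fin n → ℝ) →ₗ[ℝ] (Fin 2 → ℝ),
      (2 : ℝ) ^ (c * (Real.logb 2 n) ^ 2) ≤ (birkhoffShadowVertexCount L : ℝ)

/-- NAMED FACT (**Hrubeš–Yehudayoff 2021, Proposition 23, upper half**: "`σ(DS_n) ≤ 2^{O(n)}`";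
proof: "`σ(DS_{2n}) ≤ 2·C(2n, n)·σ(DS_n)` … By induction, this indeed implies `σ(DS_n) ≤ 2^{O(n)}`",
Remark 24: "more exactly of the form `2^{(2−o(1))n}`"). Rendered: there are `C` and `n₀` such that for
every `n ≥ n₀` and EVERY linear `L : ℝ^{n×n} → ℝ²` the projected permutation matrices span a polygon
with at most `2^{C·n}` vertices. Users take `(h : HrubesYehudayoff2021_prop23_upper)`.
[cite: HrubesYehudayoff2021, Prop. 23 and Remark 24] -/
def HrubesYehudayoff2021_prop23_upper : Prop :=
  ∃ C : ℝ, ∃ n₀ : ℕ, ∀ n : ℕ, n₀ ≤ n →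
    ∀ L : (Fin n × Fin n → ℝ) →ₗ[ℝ] (Fin 2 → ℝ),
      (birkhoffShadowVertexCount L : ℝ) ≤ (2 : ℝ) ^ (C * n)

/-- Sanity check of the encoding (non-vacuity of the vertex set): the identity permutation matrix
is one of the points. [folklore] -/
theorem permMatrixPoints_nonempty (n : ℕ) : (permMatrixPoints n).Nonempty :=
  ⟨fun ij => if (Equiv.refl (Fin n)) ij.2 = ij.1 then 1 else 0, Equiv.refl _, rfl⟩

end Literature.Computability.AlgebraicComplexity

end
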